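import Summits.CriticalPhenomena.CardyFormulaZ2.Theorems.CardyComplexConeParafermionToSLESixFamiliesPercDomainMarkov
import Literature.Probability.Percolation.FourArmGarbanOrthogonality
import HarnessLib

/-!
# The event identity of the slit crossing: conditional crossing probability = slit crossing

Crux `Summit.CriticalPhenomena.CardyFormulaZ2.Theses.CardyUniqueLimit.CardyRigidity`
(stmt-CriticalPhenomena-0746), line `crossing_martingale`, stub `stub_slitObservableApprox`
(THE HEART, `PercSlitObservableApprox f`), piece **(P-approx)(i) "event identity"**
(Camia–Newman 2007, §5; Smirnov 2001, §2: "conditionally on the exploration path up to time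
`t`, the crossing probability is the crossing probability of the slit domain, the left side of
the path being open").  For admissible Dobrushin data `D` on `δℤ²`, the FIXED crossing event

    Q = freeCrossing D X₁ X₂ = {ω | some x ∈ X₁ is joined to some y ∈ X₂ by free ω-open edges of Ω_δ}

(free edges, `DiscreteDobrushin.IsFreeEdge`: edges of `Ω_δ` neither wired `A`–`A` nor touching
the dual-wired arc `B` — the genuinely random edges; for the crux `X₁ = darc(u₂,u₁)`,
`X₂ = darc(u₀,a)` are pieces of the discrete arc `A`) has, conditionally on the exploration
prefix of depth `n` (the prefix event `explorationCylinder hD ω₀ n`, domain Markov property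
`percSlitExpectation` of `…PercDomainMarkov.lean`), the conditional probability

    percSlitExpectation hD p n (1_Q) ω₀ = P_p (slitCrossing hD X₁ X₂ ω₀ n)

where `slitCrossing hD X₁ X₂ ω₀ n` is the crossing event of the SLIT STRUCTURE: some `x ∈ X₁`
is joined to `X₂ ∪ leftBank hD ω₀ n` (the left vertices of the explored corners) by free
`ω`-open edges of `Ω_δ` that are NOT among the revealed edges of the prefix (`slitGraph`) — an
event of the fresh configuration off the revealed edges (`slitGraph_freeze`).  The identity
holds exactly when the left bank has touched the arc `A` only inside `X₂`
(`leftBank hD ω₀ n ∩ D.zdArcA ⊆ X₂`: no close encounter with `A` beyond `u₀` up to depth `n`);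
in general the slit crossing event is the conditional form of the crossing towards
`X₂ ∪ (leftBank ∩ A)` (`mem_slitCrossing_iff_of_mem_explorationCylinder`).

Ingredients: a free open path meets the revealed edges first at a FOLLOWED edge, whose endpoints
are left-bank vertices (`exists_reachable_slitGraph_of_walk`); every left-bank vertex is joined
by followed free open edges to the last contact of the bank with `A`
(`exists_zdArcA_reachable_freeOpenGraph`, free-edge form of `leftBank_exists_zdArcA_reachable`).
-/

noncomputable section

open MeasureTheory Set
open Literature.Probability Literature.Probability.LatticeModels Literature.Probability.Percolation
open Literature.Probability.LatticeModels.DiscreteDobrushin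
open Summit.CriticalPhenomena.CardyFormulaZ2.Cruxes.ParafermionToSLESixFamilies.CaratheodoryNetSlitUniformity
  (revealedFreeEdges freeze percSlitExpectation explorationCylinder_eq_setOf_revealedFreeEdges
    measurable_freeze revealedFreeEdges_eq_of_mem)

namespace Summit.CriticalPhenomena.CardyFormulaZ2.Cruxes.CardyRigidity.CrossingMartingale

namespace EventIdentity

variable {D : DiscreteDobrushin}

/-! ### The fixed crossing event through free open edges -/

/-- The graph of the free `ω`-open edges of `Ω_δ` (`IsFreeEdge`: edges of the discrete domain
neither wired `A`–`A` nor touching the arc `B`). [cite: Smirnov2010, §2.1] -/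
def freeOpenGraph (D : DiscreteDobrushin) (ω : BondConfig (Site 2)) : SimpleGraph (Site 2) :=
  SimpleGraph.fromEdgeSet {e | D.IsFreeEdge e ∧ e ∈ ω}

/-- **The fixed crossing event** `Q`: some vertex of `X₁` is joined to some vertex of `X₂` by
free `ω`-open edges of `Ω_δ`. [cite: Smirnov2001, §2] -/
def freeCrossing (D : DiscreteDobrushin) (X₁ X₂ : Set (Site 2)) : Set (BondConfig (Site 2)) :=
  {ω | ∃ x ∈ X₁, ∃ y ∈ X₂, (freeOpenGraph D ω).Reachable x y}

/-- Adjacency in the free open graph. [folklore] -/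
theorem freeOpenGraph_adj {ω : BondConfig (Site 2)} {v w : Site 2} :
    (freeOpenGraph D ω).Adj v w ↔ D.IsFreeEdge s(v, w) ∧ s(v, w) ∈ ω := by
  rw [freeOpenGraph, SimpleGraph.fromEdgeSet_adj]
  exact ⟨fun h ↦ h.1, fun h ↦ ⟨h, ((SimpleGraph.mem_edgeSet _).1 h.1.1).ne⟩⟩

/-- For a free edge, raw openness is openness in the completed configuration; hence the free
open graph is read off `D.bcBondConfig ω`. [cite: Smirnov2010, §2.1] -/
theorem freeOpenGraph_eq_of_bcBondConfig_eq {ω ω' : BondConfig (Site 2)}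
    (h : D.bcBondConfig ω = D.bcBondConfig ω') : freeOpenGraph D ω = freeOpenGraph D ω' := by
  ext v w
  rw [freeOpenGraph_adj, freeOpenGraph_adj]
  refine and_congr_right fun hf ↦ ?_
  rw [← mem_bcBondConfig_iff_of_isFreeEdge hf ω, ← mem_bcBondConfig_iff_of_isFreeEdge hf ω', h]

/-- The crossing event is monotone in the target set. [folklore] -/
theorem freeCrossing_mono {X₁ X₂ X₂' : Set (Site 2)} (h : X₂ ⊆ X₂') :
    freeCrossing D X₁ X₂ ⊆ freeCrossing D X₁ X₂' :=
  fun _ ⟨x, hx, y, hy, hr⟩ ↦ ⟨x, hx, y, h hy, hr⟩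

/-- The crossing event is measurable (it is read off the finitely many edges of `Ω_δ`).
[folklore] -/
theorem measurableSet_freeCrossing (hD : D.IsZdAdmissible) (X₁ X₂ : Set (Site 2)) :
    MeasurableSet (freeCrossing D X₁ X₂) :=
  measurableSet_of_bcInvariant hD fun ω ω' h ↦ by
    simp only [freeCrossing, mem_setOf_eq, freeOpenGraph_eq_of_bcBondConfig_eq h]

/-! ### The left bank, the slit graph and the slit crossing event of a prefix -/

variable (hD : D.IsZdAdmissible)

/-- **The left bank of the prefix of depth `n`**: the left vertices of the explored corners
`0, …, min n N(ω₀)` of the exploration of `ω₀`. [cite: Smirnov2001, §2] -/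
def leftBank (ω₀ : BondConfig (Site 2)) (n : ℕ) : Set (Site 2) :=
  {v | ∃ i ≤ min n (exitTime hD ω₀), (cornerOrbit (D.bcBondConfig ω₀) (startCorner hD) i).1 = v}

/-- **The slit graph**: the free `ω`-open edges of `Ω_δ` that are not revealed by the prefix of
depth `n` of the exploration of `ω₀`. [cite: CamiaNewman2007, §5] -/
def slitGraph (ω₀ : BondConfig (Site 2)) (n : ℕ) (ω : BondConfig (Site 2)) : SimpleGraph (Site 2) :=
  SimpleGraph.fromEdgeSet {e | D.IsFreeEdge e ∧ e ∈ ω ∧ e ∉ revealedFreeEdges hD ω₀ n}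

/-- **The slit crossing event**: some vertex of `X₁` is joined in the slit graph to a vertex of
`X₂` or of the left bank. [cite: CamiaNewman2007, §5] -/
def slitCrossing (X₁ X₂ : Set (Site 2)) (ω₀ : BondConfig (Site 2)) (n : ℕ) :
    Set (BondConfig (Site 2)) :=
  {ω | ∃ x ∈ X₁, ∃ y ∈ X₂ ∪ leftBank hD ω₀ n, (slitGraph hD ω₀ n ω).Reachable x y}

variable {hD}

/-- Left vertices of explored corners are on the left bank. [folklore] -/
theorem fst_cornerOrbit_mem_leftBank {ω₀ : BondConfig (Site 2)} {n i : ℕ}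
    (hi : i ≤ min n (exitTime hD ω₀)) :
    (cornerOrbit (D.bcBondConfig ω₀) (startCorner hD) i).1 ∈ leftBank hD ω₀ n :=
  ⟨i, hi, rfl⟩

/-- Adjacency in the slit graph. [folklore] -/
theorem slitGraph_adj {ω₀ ω : BondConfig (Site 2)} {n : ℕ} {v w : Site 2} :
    (slitGraph hD ω₀ n ω).Adj v w ↔
      D.IsFreeEdge s(v, w) ∧ s(v, w) ∈ ω ∧ s(v, w) ∉ revealedFreeEdges hD ω₀ n := by
  rw [slitGraph, SimpleGraph.fromEdgeSet_adj]
  exact ⟨fun h ↦ h.1, fun h ↦ ⟨h, ((SimpleGraph.mem_edgeSet _).1 h.1.1).ne⟩⟩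

/-- The slit graph is a subgraph of the free open graph. [folklore] -/
theorem slitGraph_le_freeOpenGraph (ω₀ : BondConfig (Site 2)) (n : ℕ) (ω : BondConfig (Site 2)) :
    slitGraph hD ω₀ n ω ≤ freeOpenGraph D ω := fun v w h ↦ by
  rw [slitGraph_adj] at h
  exact freeOpenGraph_adj.2 ⟨h.1, h.2.1⟩

/-- **The slit graph does not see the revealed edges**: freezing the configuration to `ω₀` on
the revealed free edges does not change it. [folklore] -/
theorem slitGraph_freeze (ω₀ : BondConfig (Site 2)) (n : ℕ) (ω : BondConfig (Site 2)) :
    slitGraph hD ω₀ n (freeze hD ω₀ n ω) = slitGraph hD ω₀ n ω := by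
  ext v w
  simp only [slitGraph_adj, freeze, mem_union, mem_sdiff, mem_inter_iff]
  constructor
  · rintro ⟨hf, h | h, hR⟩
    · exact ⟨hf, h.1, hR⟩
    · exact (hR h.2).elim
  · rintro ⟨hf, h, hR⟩
    exact ⟨hf, Or.inl ⟨h, hR⟩, hR⟩

/-- The slit graph is read off the completed configuration. [folklore] -/
theorem slitGraph_eq_of_bcBondConfig_eq {ω₀ ω ω' : BondConfig (Site 2)} {n : ℕ}
    (h : D.bcBondConfig ω = D.bcBondConfig ω') : slitGraph hD ω₀ n ω = slitGraph hD ω₀ n ω' := by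
  ext v w
  rw [slitGraph_adj, slitGraph_adj]
  refine and_congr_right fun hf ↦ ?_
  rw [← mem_bcBondConfig_iff_of_isFreeEdge hf ω, ← mem_bcBondConfig_iff_of_isFreeEdge hf ω', h]

/-- The slit crossing event is an event of the fresh configuration off the revealed edges:
invariant under freezing. [folklore] -/
theorem freeze_mem_slitCrossing_iff {X₁ X₂ : Set (Site 2)} {ω₀ ω : BondConfig (Site 2)} {n : ℕ} :
    freeze hD ω₀ n ω ∈ slitCrossing hD X₁ X₂ ω₀ n ↔ ω ∈ slitCrossing hD X₁ X₂ ω₀ n := by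
  simp only [slitCrossing, mem_setOf_eq, slitGraph_freeze]

/-- The slit crossing event is measurable. [folklore] -/
theorem measurableSet_slitCrossing (X₁ X₂ : Set (Site 2)) (ω₀ : BondConfig (Site 2)) (n : ℕ) :
    MeasurableSet (slitCrossing hD X₁ X₂ ω₀ n) :=
  measurableSet_of_bcInvariant hD fun ω ω' h ↦ by
    simp only [slitCrossing, mem_setOf_eq, slitGraph_eq_of_bcBondConfig_eq h]

/-- The left bank is a class function of the prefix event. [cite: DuminilCopinSmirnov2012Clay, §6.2] -/
theorem leftBank_eq_of_mem {ω₀ ω : BondConfig (Site 2)} {n : ℕ} (h : ω ∈ explorationCylinder hD ω₀ n) :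
    leftBank hD ω n = leftBank hD ω₀ n := by
  have hm := min_exitTime_eq_of_mem_explorationCylinder h
  ext v
  simp only [leftBank, mem_setOf_eq, hm]
  exact exists_congr fun i ↦ and_congr_right fun hi ↦ by rw [h i hi]

/-- The slit crossing event is a class function of the prefix event. [cite: DuminilCopinSmirnov2012Clay, §6.2] -/
theorem slitCrossing_eq_of_mem (X₁ X₂ : Set (Site 2)) {ω₀ ω : BondConfig (Site 2)} {n : ℕ}
    (h : ω ∈ explorationCylinder hD ω₀ n) :
    slitCrossing hD X₁ X₂ ω n = slitCrossing hD X₁ X₂ ω₀ n := by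
  ext ω'
  simp only [slitCrossing, slitGraph, mem_setOf_eq, leftBank_eq_of_mem h, revealedFreeEdges_eq_of_mem h]

/-- The frozen configuration lies in the prefix event. [folklore] -/
theorem freeze_mem_explorationCylinder (ω₀ : BondConfig (Site 2)) (n : ℕ) (ω : BondConfig (Site 2)) :
    freeze hD ω₀ n ω ∈ explorationCylinder hD ω₀ n := by
  rw [explorationCylinder_eq_setOf_revealedFreeEdges]
  intro e he
  simp only [freeze, mem_union, mem_sdiff, mem_inter_iff]
  exact ⟨fun h ↦ h.elim (fun h ↦ (h.2 he).elim) fun h ↦ h.1, fun h ↦ Or.inr ⟨h, he⟩⟩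

/-! ### Followed edges: both endpoints on the left bank -/

/-- **A revealed edge open in the completed configuration of `ω₀` was followed**: both its
endpoints are left-bank vertices (the corner after it sits at its far endpoint,
`nextCorner_of_mem`). [cite: Smirnov2001, §2] -/
theorem mem_leftBank_of_exploredEdge_mem {ω₀ : BondConfig (Site 2)} {n i : ℕ}
    (hi : i < min n (exitTime hD ω₀))
    (hopen : exploredEdge hD ω₀ i ∈ D.bcBondConfig ω₀) {z : Site 2} (hz : z ∈ exploredEdge hD ω₀ i) :
    z ∈ leftBank hD ω₀ n := by
  set p := cornerOrbit (D.bcBondConfig ω₀) (startCorner hD) i with hp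
  have he : exploredEdge hD ω₀ i = cTgt p := rfl
  rw [he, cTgt] at hz
  rcases Sym2.mem_iff.1 hz with rfl | rfl
  · exact fst_cornerOrbit_mem_leftBank hi.le
  · have hnext : cornerOrbit (D.bcBondConfig ω₀) (startCorner hD) (i + 1) =
        (p.1 + cornerUnit (p.2 + 1), p.2 + 3) := by
      rw [cornerOrbit_succ, ← hp]
      exact nextCorner_of_mem (he ▸ hopen)
    have := fst_cornerOrbit_mem_leftBank (hD := hD) (ω₀ := ω₀) (n := n) (i := i + 1) hi
    rwa [hnext] at this

/-- On the prefix event, a revealed free edge open in `ω'` was followed by the exploration of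
`ω₀`; so its endpoints are on the left bank. [cite: DuminilCopinSmirnov2012Clay, §6.2] -/
theorem mem_leftBank_of_mem_revealedFreeEdges {ω₀ ω' : BondConfig (Site 2)} {n : ℕ}
    (hω' : ω' ∈ explorationCylinder hD ω₀ n) {e : Sym2 (Site 2)}
    (he : e ∈ revealedFreeEdges hD ω₀ n) (heω' : e ∈ ω') {z : Site 2} (hz : z ∈ e) :
    z ∈ leftBank hD ω₀ n := by
  obtain ⟨i, hi, rfl, hf⟩ := he
  have h₀ : exploredEdge hD ω₀ i ∈ ω₀ := ((mem_explorationCylinder_iff_free.1 hω') i hi hf).1 heω'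
  exact mem_leftBank_of_exploredEdge_mem hi ((mem_bcBondConfig_iff_of_isFreeEdge hf ω₀).2 h₀) hz

/-! ### Cutting a free open path at its first revealed edge -/

/-- **Cutting at the first revealed edge.**  On the prefix event of `ω₀`, walk a free
`ω'`-open path; as long as it uses unrevealed edges it is a path of the slit graph, and the
first revealed edge it meets is open, hence followed, so its near endpoint is on the left bank.
Hence a free open path from (a vertex slit-reachable from) `x` to a target set `T` containing
the left bank yields a slit path from `x` to `T`. [cite: CamiaNewman2007, §5] -/
theorem exists_reachable_slitGraph_of_walk {ω₀ ω' : BondConfig (Site 2)} {n : ℕ}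
    (hω' : ω' ∈ explorationCylinder hD ω₀ n) {T : Set (Site 2)} (hT : leftBank hD ω₀ n ⊆ T)
    {x u y : Site 2} (q : (freeOpenGraph D ω').Walk u y)
    (hu : (slitGraph hD ω₀ n ω').Reachable x u) (hy : y ∈ T) :
    ∃ y' ∈ T, (slitGraph hD ω₀ n ω').Reachable x y' := by
  induction q with
  | nil => exact ⟨_, hy, hu⟩
  | @cons u c y hadj q ih =>
    obtain ⟨hf, hω⟩ := freeOpenGraph_adj.1 hadj
    by_cases hR : s(u, c) ∈ revealedFreeEdges hD ω₀ n
    · exact ⟨u, hT (mem_leftBank_of_mem_revealedFreeEdges hω' hR hω (Sym2.mem_mk_left _ _)), hu⟩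
    · exact ih (hu.trans (SimpleGraph.Adj.reachable (slitGraph_adj.2 ⟨hf, hω, hR⟩))) hy

/-! ### The left bank is anchored to the arc `A` through free open edges -/

/-- **Free-edge form of the left-bank lemma.**  For a configuration `ω` and a corner `c₀` with
vertex on `zdArcA`, the left vertex of the `i`-th orbit corner of `D.bcBondConfig ω` is joined
through FREE `ω`-open edges to the left vertex of an earlier orbit corner lying on `zdArcA`
(the last contact of the bank with `A`: after it the followed edges have an endpoint off `A`,
so they are free and raw-open). [cite: Smirnov2001, §2] -/
theorem exists_zdArcA_reachable_freeOpenGraph (D : DiscreteDobrushin) (ω : BondConfig (Site 2))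
    {c₀ : Site 2 × Fin 4} (hc₀ : c₀.1 ∈ D.zdArcA) (i : ℕ) :
    ∃ j ≤ i, (cornerOrbit (D.bcBondConfig ω) c₀ j).1 ∈ D.zdArcA ∧
      (freeOpenGraph D ω).Reachable (cornerOrbit (D.bcBondConfig ω) c₀ j).1
        (cornerOrbit (D.bcBondConfig ω) c₀ i).1 := by
  induction i with
  | zero => exact ⟨0, le_rfl, hc₀, SimpleGraph.Reachable.refl _⟩
  | succ i ih =>
    obtain ⟨j, hji, hjA, hr⟩ := ih
    set p := cornerOrbit (D.bcBondConfig ω) c₀ i with hp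
    show ∃ j ≤ i + 1, (cornerOrbit (D.bcBondConfig ω) c₀ j).1 ∈ D.zdArcA ∧
      (freeOpenGraph D ω).Reachable (cornerOrbit (D.bcBondConfig ω) c₀ j).1
        (nextCorner (D.bcBondConfig ω) p).1
    by_cases h : cTgt p ∈ D.bcBondConfig ω
    · rw [nextCorner_of_mem h]
      set v' := p.1 + cornerUnit (p.2 + 1) with hv'
      by_cases hv'A : v' ∈ D.zdArcA
      · refine ⟨i + 1, le_rfl, ?_, ?_⟩
        · show (nextCorner (D.bcBondConfig ω) p).1 ∈ D.zdArcA
          rwa [nextCorner_of_mem h]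
        · show (freeOpenGraph D ω).Reachable (nextCorner (D.bcBondConfig ω) p).1 v'
          rw [nextCorner_of_mem h]
      · refine ⟨j, hji.trans (Nat.le_succ i), hjA, hr.trans (SimpleGraph.Adj.reachable ?_)⟩
        -- the followed edge `s(p.1, v')` is free and raw-open
        obtain ⟨he, hA | ⟨hω, hB⟩⟩ := (D.mem_bcBondConfig_iff).1 h
        · exact (hv'A (hA v' (Sym2.mem_mk_right _ _))).elim
        · exact freeOpenGraph_adj.2 ⟨⟨he, hB, fun hA ↦ hv'A (hA v' (Sym2.mem_mk_right _ _))⟩, hω⟩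
    · rw [nextCorner_of_not_mem h]
      exact ⟨j, hji.trans (Nat.le_succ i), hjA, hr⟩

/-- On the prefix event of `ω₀`, every left-bank vertex of `ω₀` is joined through free
`ω'`-open edges to a left-bank vertex lying on `zdArcA`. [cite: Smirnov2001, §2] -/
theorem exists_leftBank_zdArcA_reachable {ω₀ ω' : BondConfig (Site 2)} {n : ℕ}
    (hω' : ω' ∈ explorationCylinder hD ω₀ n) {y : Site 2} (hy : y ∈ leftBank hD ω₀ n) :
    ∃ w ∈ leftBank hD ω₀ n ∩ D.zdArcA, (freeOpenGraph D ω').Reachable w y := by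
  obtain ⟨i, hi, rfl⟩ := hy
  obtain ⟨j, hji, hjA, hr⟩ := exists_zdArcA_reachable_freeOpenGraph D ω'
    (isStartCorner_startCorner hD).mem_zdArcA i
  rw [hω' i hi, hω' j (hji.trans hi)] at hr
  rw [hω' j (hji.trans hi)] at hjA
  exact ⟨_, ⟨fst_cornerOrbit_mem_leftBank (hji.trans hi), hjA⟩, hr⟩

/-! ### The event identity -/

/-- **The event identity on the prefix event.**  For `ω'` in the prefix event of `ω₀` at depth
`n`: `ω'` has a slit crossing from `X₁` to `X₂ ∪` left bank iff it has a free open crossing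
from `X₁` to `X₂ ∪ (leftBank ∩ zdArcA)`. [cite: CamiaNewman2007, §5] -/
theorem mem_slitCrossing_iff_of_mem_explorationCylinder {X₁ X₂ : Set (Site 2)}
    {ω₀ ω' : BondConfig (Site 2)} {n : ℕ} (hω' : ω' ∈ explorationCylinder hD ω₀ n) :
    ω' ∈ slitCrossing hD X₁ X₂ ω₀ n ↔
      ω' ∈ freeCrossing D X₁ (X₂ ∪ (leftBank hD ω₀ n ∩ D.zdArcA)) := by
  constructor
  · rintro ⟨x, hx, y, hy, hr⟩
    have hr' : (freeOpenGraph D ω').Reachable x y := hr.mono (slitGraph_le_freeOpenGraph ω₀ n ω')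
    rcases hy with hy | hy
    · exact ⟨x, hx, y, Or.inl hy, hr'⟩
    · obtain ⟨w, hw, hwy⟩ := exists_leftBank_zdArcA_reachable hω' hy
      exact ⟨x, hx, w, Or.inr hw, hr'.trans hwy.symm⟩
  · rintro ⟨x, hx, y, hy, ⟨q⟩⟩
    have hT : leftBank hD ω₀ n ⊆ X₂ ∪ leftBank hD ω₀ n := subset_union_right
    have hy' : y ∈ X₂ ∪ leftBank hD ω₀ n := hy.elim Or.inl fun h ↦ Or.inr h.1
    obtain ⟨y', hy'T, hr⟩ := exists_reachable_slitGraph_of_walk hω' hT q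
      (SimpleGraph.Reachable.refl _) hy'
    exact ⟨x, hx, y', hy'T, hr⟩

/-- **The event identity, no early contact.**  If up to depth `n` the left bank of `ω₀` has met
the arc `A` only inside `X₂`, then on the prefix event of `ω₀` the slit crossing event IS the
fixed crossing event `Q = freeCrossing D X₁ X₂`. [cite: CamiaNewman2007, §5] -/
theorem mem_slitCrossing_iff_mem_freeCrossing {X₁ X₂ : Set (Site 2)} {ω₀ ω' : BondConfig (Site 2)}
    {n : ℕ} (hA : leftBank hD ω₀ n ∩ D.zdArcA ⊆ X₂) (hω' : ω' ∈ explorationCylinder hD ω₀ n) :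
    ω' ∈ slitCrossing hD X₁ X₂ ω₀ n ↔ ω' ∈ freeCrossing D X₁ X₂ := by
  rw [mem_slitCrossing_iff_of_mem_explorationCylinder hω', union_eq_left.2 hA]

/-- Without the contact hypothesis, the fixed crossing event implies the slit crossing event on
the prefix event. [cite: CamiaNewman2007, §5] -/
theorem mem_slitCrossing_of_mem_freeCrossing {X₁ X₂ : Set (Site 2)} {ω₀ ω' : BondConfig (Site 2)}
    {n : ℕ} (hω' : ω' ∈ explorationCylinder hD ω₀ n) (h : ω' ∈ freeCrossing D X₁ X₂) :
    ω' ∈ slitCrossing hD X₁ X₂ ω₀ n :=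
  (mem_slitCrossing_iff_of_mem_explorationCylinder hω').2 (freeCrossing_mono subset_union_left h)

/-! ### The conditional crossing probability -/

/-- The percolation slit expectation of an indicator is the probability that the frozen
configuration lies in the event. [folklore] -/
theorem percSlitExpectation_indicator (p : unitInterval) (n : ℕ) {S : Set (BondConfig (Site 2))}
    (hS : MeasurableSet S) (ω₀ : BondConfig (Site 2)) :
    percSlitExpectation hD p n (S.indicator fun _ ↦ (1 : ℝ)) ω₀ =
      (bondPercolation (zdGraph 2) p).real (freeze hD ω₀ n ⁻¹' S) := by
  rw [← integral_indicator_one (measurable_freeze ω₀ n hS), percSlitExpectation]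
  refine integral_congr_ae (ae_of_all _ fun ω ↦ ?_)
  simp only [indicator, mem_preimage, Pi.one_apply]
  rfl

/-- **The preimage of the fixed crossing event under freezing is the slit crossing event** (no
early contact). [cite: CamiaNewman2007, §5] -/
theorem freeze_preimage_freeCrossing {X₁ X₂ : Set (Site 2)} {ω₀ : BondConfig (Site 2)} {n : ℕ}
    (hA : leftBank hD ω₀ n ∩ D.zdArcA ⊆ X₂) :
    freeze hD ω₀ n ⁻¹' freeCrossing D X₁ X₂ = slitCrossing hD X₁ X₂ ω₀ n := by
  ext ω
  rw [mem_preimage, ← mem_slitCrossing_iff_mem_freeCrossing hA (freeze_mem_explorationCylinder ω₀ n ω),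
    freeze_mem_slitCrossing_iff]

/-- In general the preimage of the crossing event towards `X₂ ∪ (leftBank ∩ A)` is the slit
crossing event. [cite: CamiaNewman2007, §5] -/
theorem freeze_preimage_freeCrossing_union {X₁ X₂ : Set (Site 2)} {ω₀ : BondConfig (Site 2)} {n : ℕ} :
    freeze hD ω₀ n ⁻¹' freeCrossing D X₁ (X₂ ∪ (leftBank hD ω₀ n ∩ D.zdArcA)) =
      slitCrossing hD X₁ X₂ ω₀ n := by
  ext ω
  rw [mem_preimage, ← mem_slitCrossing_iff_of_mem_explorationCylinder
    (freeze_mem_explorationCylinder ω₀ n ω), freeze_mem_slitCrossing_iff]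

/-- **Conditional crossing probability = slit crossing probability** (no early contact): the
percolation slit expectation at depth `n` of the indicator of `Q = freeCrossing D X₁ X₂` at `ω₀`
is the `P_p`-probability of the slit crossing event of the prefix of `ω₀`.
[cite: CamiaNewman2007, §5] -/
theorem percSlitExpectation_indicator_freeCrossing (p : unitInterval) {X₁ X₂ : Set (Site 2)}
    {ω₀ : BondConfig (Site 2)} {n : ℕ} (hA : leftBank hD ω₀ n ∩ D.zdArcA ⊆ X₂) :
    percSlitExpectation hD p n ((freeCrossing D X₁ X₂).indicator fun _ ↦ (1 : ℝ)) ω₀ =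
      (bondPercolation (zdGraph 2) p).real (slitCrossing hD X₁ X₂ ω₀ n) := by
  rw [percSlitExpectation_indicator p n (measurableSet_freeCrossing hD X₁ X₂), freeze_preimage_freeCrossing hA]

/-- In general the conditional crossing probability of `Q` is at most the slit crossing
probability, itself the conditional probability of the crossing towards `X₂ ∪ (leftBank ∩ A)`.
[cite: CamiaNewman2007, §5] -/
theorem percSlitExpectation_indicator_freeCrossing_le (p : unitInterval) (X₁ X₂ : Set (Site 2))
    (ω₀ : BondConfig (Site 2)) (n : ℕ) :
    percSlitExpectation hD p n ((freeCrossing D X₁ X₂).indicator fun _ ↦ (1 : ℝ)) ω₀ ≤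
      (bondPercolation (zdGraph 2) p).real (slitCrossing hD X₁ X₂ ω₀ n) ∧
    percSlitExpectation hD p n
        ((freeCrossing D X₁ (X₂ ∪ (leftBank hD ω₀ n ∩ D.zdArcA))).indicator fun _ ↦ (1 : ℝ)) ω₀ =
      (bondPercolation (zdGraph 2) p).real (slitCrossing hD X₁ X₂ ω₀ n) := by
  constructor
  · rw [percSlitExpectation_indicator p n (measurableSet_freeCrossing hD X₁ X₂),
      ← freeze_preimage_freeCrossing_union (hD := hD) (X₁ := X₁) (X₂ := X₂) (ω₀ := ω₀) (n := n)]
    exact measureReal_mono (preimage_mono (freeCrossing_mono subset_union_left))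
  · rw [percSlitExpectation_indicator p n (measurableSet_freeCrossing hD X₁ _),
      freeze_preimage_freeCrossing_union]

end EventIdentity

/-- **Registered form** (glue `eventIdentity_percSlitExpectation_freeCrossing` of stmt-CriticalPhenomena-0746):
for admissible data, every edge density, sets of sites `X₁, X₂`, configuration `ω₀` and depth `n` such that the
left bank of the prefix has met the arc `A` only inside `X₂`, the percolation slit expectation of the indicator
of the fixed free crossing event `X₁ ↔ X₂` at `ω₀` equals the probability of the slit crossing event
`X₁ ↔ X₂ ∪ leftBank` through unrevealed free open edges. [cite: CamiaNewman2007, §5] -/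
theorem eventIdentity_percSlitExpectation_freeCrossing : ∀ {D : Literature.Probability.LatticeModels.DiscreteDobrushin} (hD : D.IsZdAdmissible) (p : unitInterval) (X₁ X₂ : Set (Literature.Probability.LatticeModels.Site 2)) (ω₀ : Literature.Probability.Percolation.BondConfig (Literature.Probability.LatticeModels.Site 2)) (n : ℕ), EventIdentity.leftBank hD ω₀ n ∩ D.zdArcA ⊆ X₂ → Summit.CriticalPhenomena.CardyFormulaZ2.Cruxes.ParafermionToSLESixFamilies.CaratheodoryNetSlitUniformity.percSlitExpectation hD p n ((EventIdentity.freeCrossing D X₁ X₂).indicator fun _ ↦ (1 : ℝ)) ω₀ = (Literature.Probability.Percolation.bondPercolation (Literature.Probability.LatticeModels.zdGraph 2) p).real (EventIdentity.slitCrossing hD X₁ X₂ ω₀ n) :=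
  fun _ p _ _ _ _ hA ↦ EventIdentity.percSlitExpectation_indicator_freeCrossing p hA

end Summit.CriticalPhenomena.CardyFormulaZ2.Cruxes.CardyRigidity.CrossingMartingale

end
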